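import Summits.CriticalPhenomena.CardyFormulaZ2.Theorems.CardyBoundaryCoulombGasHalfPlaneMarkDensityLawBoxExhaustionPart2
import Summits.CriticalPhenomena.CardyFormulaZ2.Theorems.HalfPlaneMarkDensityLaw.Negative.MarkEvents
import Literature.Probability.Percolation.ZdOneArmPowerBound
import Literature.Probability.Percolation.RSW

/-!
# Box exhaustion for the collinear half-plane Cardy statement, part 3: the lattice sandwich

Support file (line `Sketch`, stub `stub_collinearCardy`, crux `HalfPlaneMarkDensityLaw`,
stmt-CriticalPhenomena-5661; transfer `RectilinearCardy → stub_collinearCardy`).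

For a conformal rectangle `R` whose carrier is the box `(-K, K) × (0, H)` and whose arcs `0`, `2`
are the bottom segments `[ta, tb] × {0}`, `[tc, ty] × {0}`, at mesh `δ = t/n`:

* LOWER: `bondDomainCrossingProb R (t/n) ≤ P_{1/2}[A_n ↔ [⌊cn⌋,⌊yn⌋]×{0} in ℤ×ℕ]`
  (`bondDomainCrossingProb_box_le`): the discrete arcs are the rows `{(m,1) : an ≤ m ≤ bn}`,
  `{(m,1) : cn ≤ m ≤ yn}` (part 2), a crossing of `Ω_δ` is an open lattice path in the shifted
  half-plane `ℤ × ℕ + e₁`, and `P_{1/2}` is translation invariant (`real_openCrossing_shift`);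
* UPPER: `P_{1/2}[A_n ↔ [⌊cn⌋,⌊yn⌋]×{0} in ℤ×ℕ] ≤ bondDomainCrossingProb R⁻ (t/n) + P_{1/2}[escape]`
  (`measureReal_openCrossing_halfPlane_le`) where `R⁻` has the enlarged arcs `[t(a-ε'), tb]`,
  `[t(c-ε'), ty]` (`nε' ≥ 1` absorbs the floors) and `escape` = some site of `Λ_r ⊇ A_n` is joined
  to a site outside `Λ_R`, `Λ_R ∩ (ℤ×ℕ)` inside the lattice box: a half-plane crossing either stays
  in the lattice box (then, shifted by `e₁`, it is a crossing of `Ω_δ⁻`) or exits it.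
* `tendsto_div_nat_nhdsWithin`: `δ_n = t/n → 0⁺`, to read `HasCrossingLimit` along meshes `t/n`.
-/

noncomputable section

namespace Summit.CriticalPhenomena.CardyFormulaZ2.Cruxes.HalfPlaneMarkDensityLaw.SketchLine

open Set Metric Complex MeasureTheory Filter
open Literature.Probability.LatticeModels Literature.Probability.Percolation
open Literature.Probability.RandomPlanarGeometry (ConformalRectangle)
open Summit.CriticalPhenomena.CardyFormulaZ2.Theorems.HalfPlaneMarkDensityLaw.Negative
open scoped Topology

variable {K H : ℝ}

namespace BoxExhaustion

/-! ## Generalities -/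

/-- The translate of a set of sites as a preimage. [folklore] -/
theorem image_add_eq (u : Site 2) (T : Set (Site 2)) : (· + u) '' T = {v | v - u ∈ T} := by
  ext v
  simp only [mem_image, mem_setOf_eq]
  constructor
  · rintro ⟨w, hw, rfl⟩; simpa using hw
  · intro hv; exact ⟨v - u, hv, by simp⟩

/-- **Exit from a smaller region.** An open path inside `S` from `x ∈ T` to `z` which is not an open
path inside `T` passes through a vertex of `S ∖ T`, joined to `x` inside `S`. [folklore] -/
theorem exists_exit_of_not_openConnIn {V : Type*} {ω : BondConfig V} {S T : Set V}
    {x z : V} (hx : x ∈ T) (h : ω ∈ openConnIn S x z) (hn : ω ∉ openConnIn T x z) :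
    ∃ w ∈ S, w ∉ T ∧ ω ∈ openConnIn S x w := by
  obtain ⟨hxS, hzS, ⟨W⟩⟩ := h
  suffices key : ∀ (a b : S) (W : ((openGraph ω).induce S).Walk a b), (a : V) ∈ T →
      ω ∈ openConnIn T a b ∨ ∃ w ∈ S, w ∉ T ∧ ω ∈ openConnIn S a w by
    rcases key ⟨x, hxS⟩ ⟨z, hzS⟩ W hx with h | h
    · exact absurd h hn
    · exact h
  intro a b W
  induction W with
  | nil => intro ha; exact Or.inl (openConnIn_refl ha)
  | @cons a b' b hab W ih =>
    intro ha
    have hab' : (openGraph ω).Adj a b' := hab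
    obtain ⟨hmem, hne⟩ := (openGraph_adj _ _ _).1 hab'
    by_cases hb' : (b' : V) ∈ T
    · rcases ih hb' with h | ⟨w, hwS, hwT, hw⟩
      · exact Or.inl (PlanarDuality.openConnIn_trans (openConnIn_of_adj ha hb' hmem hne) h)
      · exact Or.inr ⟨w, hwS, hwT,
          PlanarDuality.openConnIn_trans (openConnIn_of_adj a.2 b'.2 hmem hne) hw⟩
    · exact Or.inr ⟨b', b'.2, hb', openConnIn_of_adj a.2 b'.2 hmem hne⟩

/-- `δ_n = t/n → 0⁺` for `t > 0`. [folklore] -/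
theorem tendsto_div_nat_nhdsWithin {t : ℝ} (ht : 0 < t) :
    Tendsto (fun n : ℕ => t / n) atTop (𝓝[>] (0 : ℝ)) := by
  rw [tendsto_nhdsWithin_iff]
  refine ⟨tendsto_const_div_atTop_nhds_zero_nat t, ?_⟩
  filter_upwards [eventually_ge_atTop 1] with n hn
  exact div_pos ht (by exact_mod_cast hn)

/-- Reading a mesh limit `p δ → L` (`δ → 0⁺`) along the meshes `δ_n = t/n`. [folklore] -/
theorem tendsto_comp_div_nat {p : ℝ → ℝ} {L t : ℝ} (ht : 0 < t) (h : Tendsto p (𝓝[>] 0) (𝓝 L)) :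
    Tendsto (fun n : ℕ => p (t / n)) atTop (𝓝 L) :=
  h.comp (tendsto_div_nat_nhdsWithin ht)

/-- `P_{1/2}`-almost every configuration is a lattice configuration. [folklore] -/
theorem ae_subset_edgeSet : ∀ᵐ ω ∂μ, ω ⊆ (zdGraph 2).edgeSet := by
  unfold μ bondPercolation
  exact ProbabilityTheory.setBernoulli_ae_subset

/-- From `t a ≤ (t/n) m` to `⌊a n⌋ ≤ m`. [folklore] -/
theorem floor_le_of_mul_le {t a : ℝ} (ht : 0 < t) {n : ℕ} (hn : 0 < n) {m : ℤ}
    (h : t * a ≤ t / n * m) : ⌊a * n⌋ ≤ m := by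
  have hn' : (0 : ℝ) < n := by exact_mod_cast hn
  have e : t / n * m = t * (m / n) := by ring
  rw [e] at h
  have h1 : a ≤ m / n := le_of_mul_le_mul_left h ht
  have h2 : a * n ≤ m := (le_div_iff₀ hn').1 h1
  exact_mod_cast (Int.floor_le (a * n)).trans h2

/-- From `(t/n) m ≤ t b` to `m ≤ ⌊b n⌋`. [folklore] -/
theorem le_floor_of_mul_le {t b : ℝ} (ht : 0 < t) {n : ℕ} (hn : 0 < n) {m : ℤ}
    (h : t / n * m ≤ t * b) : m ≤ ⌊b * n⌋ := by
  have hn' : (0 : ℝ) < n := by exact_mod_cast hn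
  have e : t / n * m = t * (m / n) := by ring
  rw [e] at h
  have h1 : m / n ≤ b := le_of_mul_le_mul_left h ht
  have h2 : (m : ℝ) ≤ b * n := (div_le_iff₀ hn').1 h1
  exact Int.le_floor.2 h2

/-- From `⌊a n⌋ ≤ m` and `a' n + 1 ≤ a n` to `t a' ≤ (t/n) m`. [folklore] -/
theorem mul_le_of_floor_le {t a a' : ℝ} (ht : 0 < t) {n : ℕ} (hn : 0 < n) {m : ℤ}
    (ha' : a' * n + 1 ≤ a * n) (h : ⌊a * n⌋ ≤ m) : t * a' ≤ t / n * m := by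
  have hn' : (0 : ℝ) < n := by exact_mod_cast hn
  have h1 : (⌊a * n⌋ : ℝ) ≤ m := by exact_mod_cast h
  have h2 : a * n < ⌊a * n⌋ + 1 := Int.lt_floor_add_one _
  have h3 : a' * n ≤ m := by linarith
  have h4 : a' ≤ m / n := (le_div_iff₀ hn').2 h3
  calc t * a' ≤ t * (m / n) := mul_le_mul_of_nonneg_left h4 ht.le
    _ = t / n * m := by ring

/-- From `m ≤ ⌊b n⌋` to `(t/n) m ≤ t b`. [folklore] -/
theorem mul_le_of_le_floor {t b : ℝ} (ht : 0 < t) {n : ℕ} (hn : 0 < n) {m : ℤ}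
    (h : m ≤ ⌊b * n⌋) : t / n * m ≤ t * b := by
  have hn' : (0 : ℝ) < n := by exact_mod_cast hn
  have h1 : (m : ℝ) ≤ ⌊b * n⌋ := by exact_mod_cast h
  have h2 : (⌊b * n⌋ : ℝ) ≤ b * n := Int.floor_le _
  have h4 : m / n ≤ b := (div_le_iff₀ hn').2 (h1.trans h2)
  calc t / n * m = t * (m / n) := by ring
    _ ≤ t * b := mul_le_mul_of_nonneg_left h4 ht.le

/-! ## LOWER: a crossing of `Ω_δ` is a crossing of the shifted lattice half-plane -/

/-- A crossing of the discretised box between the discrete arcs of `[ta, tb] × {0}` and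
`[tc, ty] × {0}` at mesh `t/n` is an open crossing of `ℤ × ℕ + e₁` from `A_n + e₁` to
`[⌊cn⌋, ⌊yn⌋] × {0} + e₁`. [folklore] -/
theorem discreteCrossing_box_subset (hK : 0 < K) {t : ℝ} (ht : 0 < t) {n : ℕ} (hn : 0 < n)
    {a b c y : ℝ} (hab : a ≤ b) (hcy : c ≤ y) (hH2 : 2 * (t / n) < H)
    (ha : -K < t * a - t / n) (hb : t * b + t / n < K) (hc : -K < t * c - t / n)
    (hy : t * y + t / n < K) :
    discreteCrossing (Ioo (-K) K ×ℂ Ioo 0 H) (t / n)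
        {z : ℂ | z.im = 0 ∧ z.re ∈ Icc (t * a) (t * b)} {z : ℂ | z.im = 0 ∧ z.re ∈ Icc (t * c) (t * y)} ⊆
      openCrossing ((· + (![0, 1] : Site 2)) '' halfPlane)
        ((· + (![0, 1] : Site 2)) '' arcA a b n)
        ((· + (![0, 1] : Site 2)) '' rowIcc ⌊c * n⌋ ⌊y * n⌋) := by
  rintro ω ⟨x, hx, z, hz, hr⟩
  have hδ : 0 < t / n := div_pos ht (by exact_mod_cast hn)
  obtain ⟨hx1, hxa, hxb⟩ := discreteArc_boxDomain_subset hδ hK hH2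
    (mul_le_mul_of_nonneg_left hab ht.le) (by linarith) (by linarith) hx
  obtain ⟨hz1, hzc, hzy⟩ := discreteArc_boxDomain_subset hδ hK hH2
    (mul_le_mul_of_nonneg_left hcy ht.le) (by linarith) (by linarith) hz
  have hxD : x ∈ meshDomain (Ioo (-K) K ×ℂ Ioo 0 H) (t / n) :=
    meshBoundary_subset_meshDomain _ _ (discreteArc_subset_meshBoundary _ _ _ hx)
  have hconn := openConnIn_meshDomain_of_reachable hxD hr
  rw [meshDomain_boxDomain hδ] at hconn
  refine ⟨x, ?_, z, ?_, openConnIn_mono ?_ _ _ hconn⟩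
  · rw [image_add_eq]
    show x - ![0, 1] ∈ arcA a b n
    simp only [arcA, mem_setOf_eq, Pi.sub_apply, Matrix.cons_val_one, Matrix.cons_val_zero,
      sub_zero]
    exact ⟨by rw [hx1]; ring, floor_le_of_mul_le ht hn hxa, le_floor_of_mul_le ht hn hxb⟩
  · rw [image_add_eq]
    show z - ![0, 1] ∈ rowIcc ⌊c * n⌋ ⌊y * n⌋
    simp only [rowIcc, mem_setOf_eq, Pi.sub_apply, Matrix.cons_val_one, Matrix.cons_val_zero,
      sub_zero]
    exact ⟨by rw [hz1]; ring, floor_le_of_mul_le ht hn hzc, le_floor_of_mul_le ht hn hzy⟩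
  · intro v hv
    rw [image_add_eq]
    show v - ![0, 1] ∈ halfPlane
    simp only [halfPlane, mem_setOf_eq, Pi.sub_apply, Matrix.cons_val_one, sub_nonneg]
    exact one_le_of_mul_pos hδ (mem_meshVertices_boxDomain.1 hv).2.1

/-- **LOWER bound.** For a conformal rectangle whose carrier is the box and whose arcs `0`, `2` are
`[ta, tb] × {0}`, `[tc, ty] × {0}`: `bondDomainCrossingProb R (t/n) ≤ P_{1/2}[A_n ↔ [⌊cn⌋,⌊yn⌋]×{0}
in ℤ × ℕ]` (translation invariance of `P_{1/2}`). [folklore] -/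
theorem bondDomainCrossingProb_box_le (hK : 0 < K) {t : ℝ} (ht : 0 < t) {n : ℕ} (hn : 0 < n)
    {a b c y : ℝ} (hab : a ≤ b) (hcy : c ≤ y) (hH2 : 2 * (t / n) < H)
    (ha : -K < t * a - t / n) (hb : t * b + t / n < K) (hc : -K < t * c - t / n)
    (hy : t * y + t / n < K) (R : ConformalRectangle) (hRc : R.carrier = Ioo (-K) K ×ℂ Ioo 0 H)
    (hR0 : R.arc 0 = {z : ℂ | z.im = 0 ∧ z.re ∈ Icc (t * a) (t * b)})
    (hR2 : R.arc 2 = {z : ℂ | z.im = 0 ∧ z.re ∈ Icc (t * c) (t * y)}) :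
    bondDomainCrossingProb R (t / n) ≤
      μ.real (openCrossing halfPlane (arcA a b n) (rowIcc ⌊c * n⌋ ⌊y * n⌋)) := by
  rw [bondDomainCrossingProb_eq_measureReal, hRc, hR0, hR2]
  calc _ ≤ μ.real (openCrossing ((· + (![0, 1] : Site 2)) '' halfPlane)
        ((· + (![0, 1] : Site 2)) '' arcA a b n)
        ((· + (![0, 1] : Site 2)) '' rowIcc ⌊c * n⌋ ⌊y * n⌋)) :=
        measureReal_mono (discreteCrossing_box_subset hK ht hn hab hcy hH2 ha hb hc hy)
          (measure_ne_top _ _)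
    _ = _ := real_openCrossing_shift half _ _ _ _

/-! ## UPPER: a half-plane crossing stays in the lattice box or escapes it -/

/-- A crossing of the shifted lattice box `{v | 1 ≤ v 1} ∩ Λ + e₁` from `A_n + e₁` to
`[⌊cn⌋,⌊yn⌋]×{0} + e₁` by a lattice configuration is a crossing of `Ω_δ` between the discrete arcs
of the ENLARGED bottom segments `[t a', t b]`, `[t c', t y]` (`a' n + 1 ≤ a n`, `c' n + 1 ≤ c n`
absorb the floors). [folklore] -/
theorem shift_openCrossing_subset_discreteCrossing (hK : 0 < K) {t : ℝ} (ht : 0 < t) {n : ℕ}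
    (hn : 0 < n) {a a' b c c' y : ℝ} (ha' : a' * n + 1 ≤ a * n) (hc' : c' * n + 1 ≤ c * n)
    (hH2 : 2 * (t / n) ≤ H) (h0 : -K + t / n ≤ t * a') (h1 : t * b + t / n ≤ K)
    (h2 : -K + t / n ≤ t * c') (h3 : t * y + t / n ≤ K) {ω : BondConfig (Site 2)}
    (hωE : ω ⊆ (zdGraph 2).edgeSet)
    (hω : ω ∈ openCrossing
      ((· + (![0, 1] : Site 2)) ''
        {v : Site 2 | 0 ≤ v 1 ∧ -K < t / n * v 0 ∧ t / n * v 0 < K ∧ t / n * (v 1 + 1) < H})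
      ((· + (![0, 1] : Site 2)) '' arcA a b n)
      ((· + (![0, 1] : Site 2)) '' rowIcc ⌊c * n⌋ ⌊y * n⌋)) :
    ω ∈ discreteCrossing (Ioo (-K) K ×ℂ Ioo 0 H) (t / n)
      {z : ℂ | z.im = 0 ∧ z.re ∈ Icc (t * a') (t * b)} {z : ℂ | z.im = 0 ∧ z.re ∈ Icc (t * c') (t * y)} := by
  have hδ : 0 < t / n := div_pos ht (by exact_mod_cast hn)
  obtain ⟨x, hx, z, hz, hconn⟩ := hω
  rw [image_add_eq] at hx hz
  change x - ![0, 1] ∈ arcA a b n at hx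
  change z - ![0, 1] ∈ rowIcc ⌊c * n⌋ ⌊y * n⌋ at hz
  simp only [arcA, rowIcc, mem_setOf_eq, Pi.sub_apply, Matrix.cons_val_one, Matrix.cons_val_zero,
    sub_zero, sub_eq_zero] at hx hz
  refine ⟨x, ?_, z, ?_, reachable_of_openConnIn_boxDomain hδ hωE (openConnIn_mono ?_ _ _ hconn)⟩
  · exact mem_discreteArc_boxDomain hδ hK hH2 h0 h1 hx.1 (mul_le_of_floor_le ht hn ha' hx.2.1)
      (mul_le_of_le_floor ht hn hx.2.2)
  · exact mem_discreteArc_boxDomain hδ hK hH2 h2 h3 hz.1 (mul_le_of_floor_le ht hn hc' hz.2.1)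
      (mul_le_of_le_floor ht hn hz.2.2)
  · intro v hv
    rw [image_add_eq] at hv
    simp only [mem_setOf_eq, Pi.sub_apply, Matrix.cons_val_one, Matrix.cons_val_zero, sub_zero,
      sub_nonneg, Int.cast_sub, Int.cast_one, sub_add_cancel] at hv
    rw [mem_meshVertices_boxDomain]
    have : (1 : ℝ) ≤ v 1 := by exact_mod_cast hv.1
    exact ⟨⟨hv.2.1, hv.2.2.1⟩, by positivity, hv.2.2.2⟩

/-- A half-plane crossing from `A_n` that is not a crossing of the lattice box
`Λ = {0 ≤ v₁, |δ v₀| < K, δ (v₁ + 1) < H}` escapes: some site of `Λ_r ⊇ A_n` is joined to a site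
outside `Λ_R` (when `δ (R + 1) < min K H`, so that `Λ_R ∩ (ℤ × ℕ) ⊆ Λ`). [folklore] -/
theorem diff_subset_escape {t : ℝ} (ht : 0 < t) {n : ℕ} (hn : 0 < n) {a b : ℝ}
    {C : Set (Site 2)} {r R : ℕ} (hr : ∀ m : ℤ, ⌊a * n⌋ ≤ m → m ≤ ⌊b * n⌋ → |m| ≤ r)
    (hrR : r ≤ R) (hR : t / n * (R + 1) < min K H) :
    openCrossing halfPlane (arcA a b n) C \
        openCrossing {v : Site 2 | 0 ≤ v 1 ∧ -K < t / n * v 0 ∧ t / n * v 0 < K ∧ t / n * (v 1 + 1) < H}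
          (arcA a b n) C ⊆
      {ω | ∃ x ∈ box 2 r, ∃ y ∉ box 2 R, ω ∈ openConnIn univ x y} := by
  rintro ω ⟨⟨x, hxA, z, hzC, hconn⟩, hF⟩
  have hδ : 0 < t / n := div_pos ht (by exact_mod_cast hn)
  set B : Set (Site 2) :=
    {v : Site 2 | 0 ≤ v 1 ∧ -K < t / n * v 0 ∧ t / n * v 0 < K ∧ t / n * (v 1 + 1) < H} with hB
  have hRK : t / n * (R + 1) < K := lt_of_lt_of_le hR (min_le_left _ _)
  have hRH : t / n * (R + 1) < H := lt_of_lt_of_le hR (min_le_right _ _)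
  have hxA' := hxA
  simp only [arcA, mem_setOf_eq] at hxA'
  have hxr : |x 0| ≤ r := hr _ hxA'.2.1 hxA'.2.2
  have hrR' : (r : ℝ) ≤ R := by exact_mod_cast hrR
  have hR0 : (0 : ℝ) ≤ R := Nat.cast_nonneg R
  have hxB : x ∈ B := by
    have hx0 : |t / n * x 0| < K := by
      rw [abs_mul, abs_of_pos hδ]
      have : |(x 0 : ℝ)| ≤ r := by rw [← Int.cast_abs]; exact_mod_cast hxr
      have h1 : t / n * |(x 0 : ℝ)| ≤ t / n * R := mul_le_mul_of_nonneg_left (this.trans hrR') hδ.le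
      linarith
    refine ⟨by rw [hxA'.1], (abs_lt.1 hx0).1, (abs_lt.1 hx0).2, ?_⟩
    have h1 : t / n * ((x 1 : ℝ) + 1) ≤ t / n * (R + 1) :=
      mul_le_mul_of_nonneg_left (by rw [hxA'.1]; push_cast; linarith) hδ.le
    linarith
  have hnot : ω ∉ openConnIn B x z := fun h => hF ⟨x, hxA, z, hzC, h⟩
  obtain ⟨w, hwS, hwB, hw⟩ := exists_exit_of_not_openConnIn hxB hconn hnot
  refine ⟨x, ?_, w, fun hwbox => hwB ?_, openConnIn_mono (subset_univ _) _ _ hw⟩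
  · rw [mem_box]
    intro i
    fin_cases i
    · exact abs_le.1 hxr
    · simp [hxA'.1]
  · rw [mem_box] at hwbox
    have h0 := hwbox 0
    have h1 := hwbox 1
    have hw1 : 0 ≤ w 1 := hwS
    have hw0 : |(w 0 : ℝ)| ≤ R := by rw [← Int.cast_abs]; exact_mod_cast abs_le.2 h0
    have hw1' : (w 1 : ℝ) ≤ R := by exact_mod_cast h1.2
    have hx0 : |t / n * w 0| < K := by
      rw [abs_mul, abs_of_pos hδ]
      have h1 : t / n * |(w 0 : ℝ)| ≤ t / n * R := mul_le_mul_of_nonneg_left hw0 hδ.le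
      linarith
    refine ⟨hw1, (abs_lt.1 hx0).1, (abs_lt.1 hx0).2, ?_⟩
    have h1 : t / n * ((w 1 : ℝ) + 1) ≤ t / n * (R + 1) :=
      mul_le_mul_of_nonneg_left (by linarith) hδ.le
    linarith

/-- **UPPER bound.** For a conformal rectangle `R⁻` whose carrier is the box and whose arcs `0`, `2`
are the enlarged segments `[t a', t b] × {0}`, `[t c', t y] × {0}` (`a' n + 1 ≤ a n`,
`c' n + 1 ≤ c n`): `P_{1/2}[A_n ↔ [⌊cn⌋,⌊yn⌋]×{0} in ℤ × ℕ] ≤ bondDomainCrossingProb R⁻ (t/n) +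
P_{1/2}[Λ_r ↔ Λ_Rᶜ]`. [folklore] -/
theorem measureReal_openCrossing_halfPlane_le (hK : 0 < K) {t : ℝ} (ht : 0 < t) {n : ℕ}
    (hn : 0 < n) {a a' b c c' y : ℝ} (ha' : a' * n + 1 ≤ a * n) (hc' : c' * n + 1 ≤ c * n)
    (hH2 : 2 * (t / n) ≤ H) (h0 : -K + t / n ≤ t * a') (h1 : t * b + t / n ≤ K)
    (h2 : -K + t / n ≤ t * c') (h3 : t * y + t / n ≤ K) {r R : ℕ}
    (hr : ∀ m : ℤ, ⌊a * n⌋ ≤ m → m ≤ ⌊b * n⌋ → |m| ≤ r) (hrR : r ≤ R)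
    (hR : t / n * (R + 1) < min K H)
    (R' : ConformalRectangle) (hRc : R'.carrier = Ioo (-K) K ×ℂ Ioo 0 H)
    (hR0 : R'.arc 0 = {z : ℂ | z.im = 0 ∧ z.re ∈ Icc (t * a') (t * b)})
    (hR2 : R'.arc 2 = {z : ℂ | z.im = 0 ∧ z.re ∈ Icc (t * c') (t * y)}) :
    μ.real (openCrossing halfPlane (arcA a b n) (rowIcc ⌊c * n⌋ ⌊y * n⌋)) ≤
      bondDomainCrossingProb R' (t / n) +
        μ.real {ω | ∃ x ∈ box 2 r, ∃ y ∉ box 2 R, ω ∈ openConnIn univ x y} := by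
  set B : Set (Site 2) :=
    {v : Site 2 | 0 ≤ v 1 ∧ -K < t / n * v 0 ∧ t / n * v 0 < K ∧ t / n * (v 1 + 1) < H} with hB
  set E := openCrossing halfPlane (arcA a b n) (rowIcc ⌊c * n⌋ ⌊y * n⌋) with hE
  set F := openCrossing B (arcA a b n) (rowIcc ⌊c * n⌋ ⌊y * n⌋) with hF
  have hsplit : E ⊆ F ∪ (E \ F) := fun ω hω => by
    by_cases h : ω ∈ F
    · exact Or.inl h
    · exact Or.inr ⟨hω, h⟩
  have hF_le : μ.real F ≤ bondDomainCrossingProb R' (t / n) := by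
    have hshift := real_openCrossing_shift (d := 2) half (![0, 1] : Site 2) B (arcA a b n)
      (rowIcc ⌊c * n⌋ ⌊y * n⌋)
    rw [bondDomainCrossingProb_eq_measureReal, hRc, hR0, hR2, hF]
    change μ.real _ ≤ μ.real _
    change μ.real _ = μ.real _ at hshift
    rw [← hshift]
    refine ENNReal.toReal_mono (measure_ne_top _ _) (measure_mono_ae ?_)
    filter_upwards [ae_subset_edgeSet] with ω hωE
    intro hω
    exact shift_openCrossing_subset_discreteCrossing hK ht hn ha' hc' hH2 h0 h1 h2 h3 hωE hω
  have hdiff_le : μ.real (E \ F) ≤ μ.real {ω | ∃ x ∈ box 2 r, ∃ y ∉ box 2 R, ω ∈ openConnIn univ x y} :=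
    measureReal_mono (diff_subset_escape ht hn hr hrR hR) (measure_ne_top _ _)
  calc μ.real E ≤ μ.real (F ∪ (E \ F)) := measureReal_mono hsplit (measure_ne_top _ _)
    _ ≤ μ.real F + μ.real (E \ F) := measureReal_union_le _ _
    _ ≤ _ := add_le_add hF_le hdiff_le

end BoxExhaustion

/-- Registered stub of this support file (part 3 of the box exhaustion): the LOWER half of the lattice
sandwich. [folklore] -/
theorem stub_boxExhaustion_lowerBound :
    ∀ (K H t : ℝ) (n : ℕ) (a b c y : ℝ) (R : ConformalRectangle), 0 < K → 0 < t → 0 < n → a ≤ b →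
      c ≤ y → 2 * (t / n) < H → -K < t * a - t / n → t * b + t / n < K → -K < t * c - t / n →
      t * y + t / n < K → R.carrier = Ioo (-K) K ×ℂ Ioo 0 H →
      R.arc 0 = {z : ℂ | z.im = 0 ∧ z.re ∈ Icc (t * a) (t * b)} →
      R.arc 2 = {z : ℂ | z.im = 0 ∧ z.re ∈ Icc (t * c) (t * y)} →
      bondDomainCrossingProb R (t / n) ≤
        μ.real (openCrossing halfPlane (arcA a b n) (rowIcc ⌊c * n⌋ ⌊y * n⌋)) :=
  fun _ _ _ _ _ _ _ _ R hK ht hn hab hcy hH2 ha hb hc hy hRc hR0 hR2 =>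
    BoxExhaustion.bondDomainCrossingProb_box_le hK ht hn hab hcy hH2 ha hb hc hy R hRc hR0 hR2

end Summit.CriticalPhenomena.CardyFormulaZ2.Cruxes.HalfPlaneMarkDensityLaw.SketchLine

end
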